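import Summits.BirchSwinnertonDyer.Rank1Residual.Additive.GordRankOneKatoCertificateClass
import Summits.BirchSwinnertonDyer.Rank1Residual.Additive.GordCycRankOneLambda
import Summits.BirchSwinnertonDyer.Rank1Residual.Additive.GordCharLeadingTermExact
import HarnessLib

/-!
# The (G)-cell at analytic rank ONE, defect 2 — WITH DELBOURGO 2002 (B): Schneider's non-degeneracy
# PROVED per pair, the EXACT identity `ord_p #Ш + ord_p Reg_p + ord_p ∏c + ord_p ℓ = 1 + 2 ord_p #tors`,
# and `BSD(E,p) ⟺ ord_p(q · Reg_p) = 1` — from Kato's / Wuthrich's divisibility and ONE `p`-adic unit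
# (cell `b2b-bsdres`, sub-cell additive-p2, gen 19; sequel of `GordRankOneKatoCertificate[Class]`)

HONEST FRAMING (cell `b2b-bsdres`, run/shared/lean/b2b/bsd-rank1-residual/, verbatim in every
file): the goal of the cell is to DELETE the COMBINATION-SHAPED residual classes of the
Birch–Swinnerton-Dyer formula for ALL analytic-rank `≤ 1` elliptic curves over `ℚ` — "full BSD
formula for every rank `≤ 1` curve in class `C`" assembled STRICTLY from published theorems — so
that the rank-`≤ 1` remainder becomes exactly the CONSTRUCTION-SHAPED classes, which are TYPED
(missing-input `Prop`s), NOT attempted. This is not "finishing BSD". Sub-cell `additive-p2`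
(CLASS-OWNERS row "X3/X4 additive — pot. good ordinary / X3♯(G-ord)"), generation 19: research
route; no claim beyond the stated classes; X3♯(G-ord)/X4♯(G-ord) stay CONSTRUCTION-SHAPED; labels /
census / located gap UNCHANGED; nothing is booked. Theorems only (no definition, no new named fact;
named facts enter as HYPOTHESES: the semistable half-eigenspace readings of Kato 2004 Thm. 17.4 (3) /
Wuthrich 2014 Thm. 16, Delbourgo 2002 (A)+(B) = A175, Pal 2012 Thm. 3.2, GZK, modularity).

What (chain and census reading in the module docstring of `GordRankOneKatoCertificate.lean`):
* §4 `schneider_and_padicVal_identity_rankOne_of_mu_zero_lam_le_one` (cell-agnostic core: `rank = 1`,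
  a (B)-datum `Dh`, and `μ = 0 ∧ λ ≤ 1` for every generator ⟹ `Reg_p(E,Dh) ≠ 0`, `Ш[p^∞]` finite, the
  exact identity — n1011-p01's `padicVal_identity_of_charLamLe` with `μ = 0`); class forms
  `ClassX4Gord.schneider_and_padicVal_identity_rankOne_of_katoHalf_of_cert`, `ClassX3Gord.…wuthrichHalf…`.
* §5 `bsdp_iff_padicValRat_add_eq_one` (bookkeeping) and **`ClassX4Gord.bsdp_iff_padicVal_rankOne_of_katoHalf_of_cert`**:
  on the non-anomalous rows `BSD(E,p) ⟺ ord_p q + ord_p Reg_p(E,Dh) = 1`, `L'(E,1) = q·Ω_E·Reg_∞(E)`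
  (X3 twin); the height conjuncts of gen 18's `RankOneIwasawaInputAt` are PROVED there, so
  `RankOneIwasawaInputAt W p ↔ BSDp W p` on the certified rows.
* §6 HEADLINE `ClassX4Gord.bsdp_iff_padicVal_rankOne_of_katoHalf_of_norm_coeff_one` (and X3 twin):
  the same from ONE `p`-adic unit (`‖[T¹](ϖ·B_{(p−1)/2})‖_p = 1`), Pal's Thm. 3.2 supplying the
  constant term at `p ≡ 1 (mod 4)`.
READING FOR THE CENSUS (ttrl2 W2 X4-2 / rmap-2 §D; EVIDENCE only): on every certified row the fitted
`p`-exponent of `R := A′/(h·#Ш_an·∏c/#tors²)` (`h` = Delbourgo-normalised height of a generator,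
`A′ = [T¹](ϖ·B)·log_p γ`) equals `(ord_p #Ш − ord_p #Ш_an) + ord_p ℓ` — the `BSD(E,p)` defect itself
(plus the `ℓ`-reading on anomalous rows), given Kato's divisibility; `b = 0` on a row ⟺ `BSD(E,p)` there.
Nothing booked; labels UNCHANGED; O7-ord OPEN.

References: D. Delbourgo, J. Number Theory 95 (2002) Thm. (A), (B) [Delbourgo2002]; K. Kato,
Astérisque 295 (2004) Thm. 17.4 (3) [Kato2004Asterisque]; C. Wuthrich, Doc. Math. 19 (2014) Thm. 16
[Wuthrich2014]; A. Pal, Canad. Math. Bull. 55 (2012) Thm. 3.2 [Pal2012]; B. Perrin-Riou, Invent.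
Math. 89 (1987) [PerrinRiou1987] (shape of the argument); W. Stein, C. Wuthrich, Math. Comp. 82
(2013) §4 [SteinWuthrich2013]; R. L. Miller, LMS J. Comput. Math. 14 (2011) Def. 1.1 [Miller2011LMS].
-/

noncomputable section

open scoped Classical MatrixGroups ModularForm NumberField

namespace Summit.BirchSwinnertonDyer.Rank1Residual.Additive

open CongruenceSubgroup WeierstrassCurve NumberField Literature.NumberTheory.EllipticCurves
  Literature.NumberTheory.EllipticCurves.ModularForms
  Literature.NumberTheory.EllipticCurves.Rank1Residual
  Literature.NumberTheory.EllipticCurves.Rank1Residual.Typed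
  Literature.NumberTheory.EllipticCurves.Delbourgo2002
  Literature.NumberTheory.GaloisRepresentations Summit.BirchSwinnertonDyer.Rank1Residual.AdditivePotMult
  Summit.BirchSwinnertonDyer.Rank1Residual.X1.MuLambda
  Summit.BirchSwinnertonDyer.Rank1Residual.X1.RankOneParitySqueeze
  IsDedekindDomain

variable {W : WeierstrassCurve ℚ} [W.IsElliptic] [W.IsGloballyMinimal] {p : ℕ} [hp : Fact p.Prime]

/-! ### §4 With Delbourgo 2002 (B): Schneider PROVED, `λ = 1`, `μ = 0`, and the EXACT identity -/

omit [W.IsGloballyMinimal] in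
/-- **Core of §4 (cell-agnostic).** Let `p ≠ 2`, `rank_ℤ E(ℚ) = 1`, `Dh` a height datum with
Delbourgo's (B)-clauses (`hB`), and suppose for every cyclotomic dual datum `D` and generator `fE`:
`X` torsion, `μ(fE) = 0`, `λ(fE) ≤ 1` (`hml`, §3). Then `Reg_p(E,Dh) ≠ 0` (Schneider, PROVED),
`Ш(E/ℚ)[p^∞]` is finite, and
`ord_p #Ш(E)[p^∞] + ord_p Reg_p(E,Dh) + ord_p ∏c_ℓ + ord_p ℓ = 1 + 2·ord_p #E(ℚ)_tors` with `ℓ ∣ p²`,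
`ℓ = 1` off the anomalous rows (n1011-p01's `padicVal_identity_of_charLamLe` with `μ = 0`, `r = 1`).
[cite: Delbourgo2002, Theorem (B) (p. 40)] [cite: Washington1997, §7.1] -/
theorem schneider_and_padicVal_identity_rankOne_of_mu_zero_lam_le_one (hp2 : p ≠ 2)
    (hr1 : W.mordellWeilRank = 1) {Dh : PAdicHeightData W p} (hB : LeadingTermClauses W p Dh)
    (hml : ∀ (κ : ZpExtension ℚ p) (γ : Field.absoluteGaloisGroup ℚ),
      κ.IsCyclotomic → κ.IsTopGenerator γ → IsCyclotomicVariable p γ →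
      ∀ (D : W.SelmerDualData κ γ) (fE : IwasawaAlgebra p), D.charIdeal = Ideal.span {fE} →
        D.IsTorsion ∧ mu fE = 0 ∧ lam fE ≤ 1) :
    SchneiderConjecture Dh ∧ Finite (AddCommGroup.primaryComponent W.sha p) ∧
      ∃ ℓ : ℕ, ℓ ∣ p ^ 2 ∧ (ReductionNonAnomalous W p → ℓ = 1) ∧
        (padicValNat p (Nat.card (AddCommGroup.primaryComponent W.sha p)) : ℤ) +
            (padicRegulator Dh).valuation + padicValNat p W.tamagawaProduct + padicValNat p ℓ =
          1 + 2 * padicValNat p W.torsionOrder := by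
  obtain ⟨κ, γ, hκ, hγ, hγ', D, fE, hchar⟩ := exists_cyclotomic_dualData_generator W p
  haveI : Module.Finite (IwasawaAlgebra p) D.X :=
    SelmerDualData.module_finite_of_isCyclotomic (W := W) (κ := κ) hκ D hγ
  obtain ⟨hX, hmu, hlam⟩ := hml κ γ hκ hγ hγ' D fE hchar
  obtain ⟨hS, hfin, -, ℓ, hℓp, hℓ1, hid⟩ := padicVal_identity_of_charLamLe W p hB hp2 hκ hγ hγ' D hX
    hchar (by rw [hr1]; exact hlam)
  refine ⟨hS, hfin, ℓ, hℓp, hℓ1, ?_⟩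
  rw [hmu, hr1, Nat.cast_zero, zero_add, Nat.cast_one] at hid
  exact hid

/-- **X4♯(G-ord) ∩ `I₀*` ∩ {`ρ̄` onto}, `p ≥ 5`, `E` non-CM, `ord_{s=1} L(E,s) = 1`: for EVERY height
datum `Dh` with Delbourgo's (B)-clauses — in particular Delbourgo's `⟨,⟩_{p,ℚ}` — the certificate gives
Schneider's `Reg_p(E,Dh) ≠ 0` (PROVED, not certified) and the EXACT identity
`ord_p #Ш(E) + ord_p Reg_p(E,Dh) + ord_p ∏c_ℓ + ord_p ℓ = 1 + 2·ord_p #E(ℚ)_tors`** (`ℓ ∣ p²`, `= 1` off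
the anomalous rows; `Ш(E)` finite by Gross–Zagier–Kolyvagin). Published inputs: Kato 17.4 (3)
component reading, GZK, modularity; kernel: [C], §1–§3, n1011-p01's §2.
[cite: Delbourgo2002, Theorem (B) (p. 40)] [cite: Kato2004Asterisque, Thm. 17.4 (3) (p. 273)] -/
theorem ClassX4Gord.schneider_and_padicVal_identity_rankOne_of_katoHalf_of_cert
    (hK : Wuthrich2014.kato_halfEigenCharIdeal_dvd_cyclotomicPrime_of_surjective)
    (hmodD : nonempty_modularParametrizationData)
    (hGZK : rank_eq_analyticRank_of_analyticRank_le_one)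
    (hX : ClassX4Gord W p) (hp5 : 5 ≤ p) (he : semistabilityIndex W p = 2) (hsurj : Surj W p)
    (hr : W.analyticRank = 1) (hcert : BranchUnitCertificateAt W p)
    {Dh : PAdicHeightData W p} (hB : LeadingTermClauses W p Dh) :
    SchneiderConjecture Dh ∧
      ∃ ℓ : ℕ, ℓ ∣ p ^ 2 ∧ (ReductionNonAnomalous W p → ℓ = 1) ∧
        (padicValNat p W.shaOrder : ℤ) + (padicRegulator Dh).valuation +
            padicValNat p W.tamagawaProduct + padicValNat p ℓ = 1 + 2 * padicValNat p W.torsionOrder := by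
  obtain ⟨hmw, hfinSha⟩ := hGZK W (by rw [hr])
  have hr1 : W.mordellWeilRank = 1 := by rw [hmw, hr]
  haveI : Finite W.sha := hfinSha
  obtain ⟨hS, -, ℓ, hℓp, hℓ1, hid⟩ :=
    schneider_and_padicVal_identity_rankOne_of_mu_zero_lam_le_one (W := W) (p := p) (by omega) hr1 hB
      fun κ γ hκ hγ hγ' D fE hchar ↦
        hX.isTorsion_and_mu_zero_lam_le_one_of_katoHalf_of_cert hK hmodD hp5 he hsurj hcert hκ hγ hγ' D
          hchar
  refine ⟨hS, ℓ, hℓp, hℓ1, ?_⟩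
  rw [padicValNat_card_addPrimaryComponent] at hid
  exact hid

/-- **X3♯(G-ord) ∩ `I₀*`, `p ≥ 5`, `E` non-CM, `ord_{s=1} L(E,s) = 1`: the same from Wuthrich's
reducible component reading** — Schneider PROVED for every (B)-datum and the exact identity
`ord_p #Ш(E) + ord_p Reg_p(E,Dh) + ord_p ∏c_ℓ + ord_p ℓ = 1 + 2·ord_p #E(ℚ)_tors`. NEW at rank one on
X3♯(G-ord) (reducible `E[p]`). [cite: Delbourgo2002, Theorem (B) (p. 40)]
[cite: Wuthrich2014, Thm. 16 (p. 397)] -/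
theorem ClassX3Gord.schneider_and_padicVal_identity_rankOne_of_wuthrichHalf_of_cert
    (hWu : Wuthrich2014.thm16_halfEigenCharIdeal_dvd_cyclotomicPrime)
    (hmodD : nonempty_modularParametrizationData)
    (hGZK : rank_eq_analyticRank_of_analyticRank_le_one)
    (hX : ClassX3Gord W p) (hp5 : 5 ≤ p) (he : semistabilityIndex W p = 2)
    (hr : W.analyticRank = 1) (hcert : BranchUnitCertificateAt W p)
    {Dh : PAdicHeightData W p} (hB : LeadingTermClauses W p Dh) :
    SchneiderConjecture Dh ∧
      ∃ ℓ : ℕ, ℓ ∣ p ^ 2 ∧ (ReductionNonAnomalous W p → ℓ = 1) ∧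
        (padicValNat p W.shaOrder : ℤ) + (padicRegulator Dh).valuation +
            padicValNat p W.tamagawaProduct + padicValNat p ℓ = 1 + 2 * padicValNat p W.torsionOrder := by
  obtain ⟨hmw, hfinSha⟩ := hGZK W (by rw [hr])
  have hr1 : W.mordellWeilRank = 1 := by rw [hmw, hr]
  haveI : Finite W.sha := hfinSha
  obtain ⟨hS, -, ℓ, hℓp, hℓ1, hid⟩ :=
    schneider_and_padicVal_identity_rankOne_of_mu_zero_lam_le_one (W := W) (p := p) (by omega) hr1 hB
      fun κ γ hκ hγ hγ' D fE hchar ↦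
        hX.isTorsion_and_mu_zero_lam_le_one_of_wuthrichHalf_of_cert hWu hmodD (by omega) he hcert hκ hγ
          hγ' D hchar
  refine ⟨hS, ℓ, hℓp, hℓ1, ?_⟩
  rw [padicValNat_card_addPrimaryComponent] at hid
  exact hid

/-! ### §5 `BSD(E,p)` ⟺ ONE valuation: `ord_p q + ord_p Reg_p(E,Dh) = 1`, `L'(E,1) = q·Ω_E·Reg_∞(E)` -/

omit [W.IsGloballyMinimal] in
/-- **Bookkeeping (cell-agnostic).** If `ord_{s=1} L(E,s) ≤ 1` (GZK: `Ш` finite, ranks agree),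
`L^{(r)}(E,1)/r! = q·Ω_E·Reg_∞(E)` with `q ≠ 0`, and
`ord_p #Ш(E) + v + ord_p ∏c_ℓ = 1 + 2·ord_p #E(ℚ)_tors` for some integer `v` (meant: `ord_p Reg_p`), then
`BSD(E,p) ⟺ ord_p q + v = 1` (`#Ш_an = q·#tors²/∏c_ℓ`). [cite: Miller2011LMS, Def. 1.1] -/
theorem bsdp_iff_padicValRat_add_eq_one (hGZK : rank_eq_analyticRank_of_analyticRank_le_one)
    (hr : W.analyticRank ≤ 1) {q : ℚ} (hq0 : q ≠ 0)
    (hLq : W.leadingLCoeff = (q : ℂ) * (W.realPeriodRat : ℂ) * (W.regulator : ℂ)) {v : ℤ}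
    (hid : (padicValNat p W.shaOrder : ℤ) + v + padicValNat p W.tamagawaProduct =
      1 + 2 * padicValNat p W.torsionOrder) :
    BSDp W p ↔ padicValRat p q + v = 1 := by
  obtain ⟨-, hfinSha⟩ := hGZK W hr
  haveI : Finite W.sha := hfinSha
  have hsha := shaAn_eq_of_leadingLCoeff_eq W hLq
  have hT0 : (W.torsionOrder : ℚ) ≠ 0 := by exact_mod_cast (W.torsionOrder_pos_holds).ne'
  have hP0 : (W.tamagawaProduct : ℚ) ≠ 0 := by
    exact_mod_cast (W.tamagawaProduct_pos_holds : 0 < W.tamagawaProduct).ne'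
  have hval : padicValRat p (q * (W.torsionOrder : ℚ) ^ 2 / (W.tamagawaProduct : ℚ)) =
      padicValRat p q + 2 * padicValNat p W.torsionOrder - padicValNat p W.tamagawaProduct := by
    rw [padicValRat.div (mul_ne_zero hq0 (pow_ne_zero 2 hT0)) hP0,
      padicValRat.mul hq0 (pow_ne_zero 2 hT0), padicValRat.pow, padicValRat.of_nat,
      padicValRat.of_nat]
    push_cast
    ring
  constructor
  · intro hbsd
    obtain ⟨q', hq', hv'⟩ := missingPPartAt_of_bsdp W p hbsd
    have hqq : q' = q * (W.torsionOrder : ℚ) ^ 2 / (W.tamagawaProduct : ℚ) := by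
      exact_mod_cast hq'.symm.trans hsha
    rw [hqq, hval] at hv'
    linarith
  · intro h
    refine bsdp_of_missingPPartAt W p hGZK hr ⟨_, hsha, ?_⟩
    rw [hval]
    linarith

/-- **X4♯(G-ord) ∩ `I₀*` ∩ {`ρ̄` onto}, `p ≥ 5`, `E` non-CM, `r_an = 1`, NON-ANOMALOUS over the
(G)-fields: `BSD(E,p) ⟺ ord_p q + ord_p Reg_p(E,Dh) = 1`** for every (B)-datum `Dh` (in particular
Delbourgo's `⟨,⟩_{p,ℚ}`), where `L'(E,1) = q·Ω_E·Reg_∞(E)` — given Kato's divisibility and the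
one-number certificate. `Ш` has disappeared: the residue is the `p`-adic Gross–Zagier VALUATION in
Delbourgo's normalisation (O7-ord's comparison, as one integer per pair).
[cite: Delbourgo2002, Theorem (B) (p. 40)] [cite: Kato2004Asterisque, Thm. 17.4 (3) (p. 273)]
[cite: Miller2011LMS, Def. 1.1] -/
theorem ClassX4Gord.bsdp_iff_padicVal_rankOne_of_katoHalf_of_cert
    (hK : Wuthrich2014.kato_halfEigenCharIdeal_dvd_cyclotomicPrime_of_surjective)
    (hmodD : nonempty_modularParametrizationData)
    (hGZK : rank_eq_analyticRank_of_analyticRank_le_one) (hmod : hasEntireLFunction_rat)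
    (hX : ClassX4Gord W p) (hp5 : 5 ≤ p) (he : semistabilityIndex W p = 2) (hsurj : Surj W p)
    (hr : W.analyticRank = 1) (hna : ReductionNonAnomalous W p) (hcert : BranchUnitCertificateAt W p)
    {Dh : PAdicHeightData W p} (hB : LeadingTermClauses W p Dh)
    {q : ℚ} (hLq : W.leadingLCoeff = (q : ℂ) * (W.realPeriodRat : ℂ) * (W.regulator : ℂ)) :
    BSDp W p ↔ padicValRat p q + (padicRegulator Dh).valuation = 1 := by
  obtain ⟨-, ℓ, -, hℓ1, hid⟩ :=
    hX.schneider_and_padicVal_identity_rankOne_of_katoHalf_of_cert hK hmodD hGZK hp5 he hsurj hr hcert hB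
  rw [hℓ1 hna, padicValNat_one_right, Nat.cast_zero, add_zero] at hid
  have hq0 : q ≠ 0 := by
    rintro rfl
    rw [Rat.cast_zero, zero_mul, zero_mul] at hLq
    exact W.leadingLCoeff_ne_zero_holds (hmod W) hLq
  exact bsdp_iff_padicValRat_add_eq_one (W := W) (p := p) hGZK (by rw [hr]) hq0 hLq hid

/-- **X3♯(G-ord) ∩ `I₀*`, `p ≥ 5`, `E` non-CM, `r_an = 1`, non-anomalous: `BSD(E,p) ⟺
ord_p q + ord_p Reg_p(E,Dh) = 1`** for every (B)-datum, given Wuthrich's divisibility and the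
certificate. [cite: Delbourgo2002, Theorem (B) (p. 40)] [cite: Wuthrich2014, Thm. 16 (p. 397)]
[cite: Miller2011LMS, Def. 1.1] -/
theorem ClassX3Gord.bsdp_iff_padicVal_rankOne_of_wuthrichHalf_of_cert
    (hWu : Wuthrich2014.thm16_halfEigenCharIdeal_dvd_cyclotomicPrime)
    (hmodD : nonempty_modularParametrizationData)
    (hGZK : rank_eq_analyticRank_of_analyticRank_le_one) (hmod : hasEntireLFunction_rat)
    (hX : ClassX3Gord W p) (hp5 : 5 ≤ p) (he : semistabilityIndex W p = 2)
    (hr : W.analyticRank = 1) (hna : ReductionNonAnomalous W p) (hcert : BranchUnitCertificateAt W p)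
    {Dh : PAdicHeightData W p} (hB : LeadingTermClauses W p Dh)
    {q : ℚ} (hLq : W.leadingLCoeff = (q : ℂ) * (W.realPeriodRat : ℂ) * (W.regulator : ℂ)) :
    BSDp W p ↔ padicValRat p q + (padicRegulator Dh).valuation = 1 := by
  obtain ⟨-, ℓ, -, hℓ1, hid⟩ :=
    hX.schneider_and_padicVal_identity_rankOne_of_wuthrichHalf_of_cert hWu hmodD hGZK hp5 he hr hcert hB
  rw [hℓ1 hna, padicValNat_one_right, Nat.cast_zero, add_zero] at hid
  have hq0 : q ≠ 0 := by
    rintro rfl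
    rw [Rat.cast_zero, zero_mul, zero_mul] at hLq
    exact W.leadingLCoeff_ne_zero_holds (hmod W) hLq
  exact bsdp_iff_padicValRat_add_eq_one (W := W) (p := p) hGZK (by rw [hr]) hq0 hLq hid

/-- **The height conjuncts of gen 18's residue predicate are PROVED on the certified rows**:
X4♯(G-ord) ∩ `I₀*` ∩ {`ρ̄` onto}, `p ≥ 5`, `E` non-CM, `r_an = 1` ⟹
`∃ Dh, LeadingTermClauses W p Dh ∧ SchneiderConjecture Dh` (A175 supplies `Dh`, §4 its non-degeneracy).
[cite: Delbourgo2002, Theorem (A), (B) (p. 40)] -/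
theorem ClassX4Gord.exists_leadingTermClauses_and_schneider_of_katoHalf_of_cert
    (hDel : Delbourgo2002.mainTheorem)
    (hK : Wuthrich2014.kato_halfEigenCharIdeal_dvd_cyclotomicPrime_of_surjective)
    (hmodD : nonempty_modularParametrizationData)
    (hGZK : rank_eq_analyticRank_of_analyticRank_le_one)
    (hX : ClassX4Gord W p) (hp5 : 5 ≤ p) (hcm : ¬ W.HasCM) (he : semistabilityIndex W p = 2)
    (hsurj : Surj W p) (hr : W.analyticRank = 1) (hcert : BranchUnitCertificateAt W p) :
    ∃ Dh : PAdicHeightData W p, LeadingTermClauses W p Dh ∧ SchneiderConjecture Dh := by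
  have hadd : ¬ W.HasGoodReductionAtPrime p ∧ ¬ W.HasMultiplicativeReductionAtPrime p := hX.addv.2
  obtain ⟨Dh, hB⟩ :=
    Delbourgo2002.mainTheorem.exists_leadingTermClauses hDel hp5 hcm hadd hX.typeGOrd
  exact ⟨Dh, hB, (hX.schneider_and_padicVal_identity_rankOne_of_katoHalf_of_cert hK hmodD hGZK hp5 he
    hsurj hr hcert hB).1⟩

/-- **On the certified rows gen 18's residue predicate IS `BSD(E,p)`**: X4♯(G-ord) ∩ `I₀*` ∩
{`ρ̄` onto}, `p ≥ 5`, `E` non-CM, `r_an = 1`, non-anomalous ⟹ `RankOneIwasawaInputAt W p ↔ BSDp W p`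
(gen 18's `rankOneIwasawaInputAt_iff_bsdp_and_exists_height` with its height conjuncts discharged).
[cite: Delbourgo2002, Theorem (A), (B) (p. 40)] [cite: Miller2011LMS, Def. 1.1] -/
theorem ClassX4Gord.rankOneIwasawaInputAt_iff_bsdp_of_katoHalf_of_cert
    (hDel : Delbourgo2002.mainTheorem)
    (hK : Wuthrich2014.kato_halfEigenCharIdeal_dvd_cyclotomicPrime_of_surjective)
    (hmodD : nonempty_modularParametrizationData)
    (hGZK : rank_eq_analyticRank_of_analyticRank_le_one) (hmod : hasEntireLFunction_rat)
    (hX : ClassX4Gord W p) (hp5 : 5 ≤ p) (hcm : ¬ W.HasCM) (he : semistabilityIndex W p = 2)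
    (hsurj : Surj W p) (hr : W.analyticRank = 1) (hna : ReductionNonAnomalous W p)
    (hcert : BranchUnitCertificateAt W p) :
    RankOneIwasawaInputAt W p ↔ BSDp W p := by
  rw [rankOneIwasawaInputAt_iff_bsdp_and_exists_height W p hDel hGZK hmod hp5 hcm hX.addv.2 hX.typeGOrd
    hr hna]
  exact ⟨fun h ↦ h.1, fun h ↦ ⟨h,
    hX.exists_leadingTermClauses_and_schneider_of_katoHalf_of_cert hDel hK hmodD hGZK hp5 hcm he hsurj
      hr hcert⟩⟩

/-- **X3 twin**: X3♯(G-ord) ∩ `I₀*`, `p ≥ 5`, `E` non-CM, `r_an = 1`, non-anomalous ⟹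
`RankOneIwasawaInputAt W p ↔ BSDp W p`. [cite: Delbourgo2002, Theorem (A), (B) (p. 40)]
[cite: Wuthrich2014, Thm. 16 (p. 397)] [cite: Miller2011LMS, Def. 1.1] -/
theorem ClassX3Gord.rankOneIwasawaInputAt_iff_bsdp_of_wuthrichHalf_of_cert
    (hDel : Delbourgo2002.mainTheorem)
    (hWu : Wuthrich2014.thm16_halfEigenCharIdeal_dvd_cyclotomicPrime)
    (hmodD : nonempty_modularParametrizationData)
    (hGZK : rank_eq_analyticRank_of_analyticRank_le_one) (hmod : hasEntireLFunction_rat)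
    (hX : ClassX3Gord W p) (hp5 : 5 ≤ p) (hcm : ¬ W.HasCM) (he : semistabilityIndex W p = 2)
    (hr : W.analyticRank = 1) (hna : ReductionNonAnomalous W p)
    (hcert : BranchUnitCertificateAt W p) :
    RankOneIwasawaInputAt W p ↔ BSDp W p := by
  have hadd : ¬ W.HasGoodReductionAtPrime p ∧ ¬ W.HasMultiplicativeReductionAtPrime p := hX.addv
  rw [rankOneIwasawaInputAt_iff_bsdp_and_exists_height W p hDel hGZK hmod hp5 hcm hX.addv hX.typeGOrd
    hr hna]
  refine ⟨fun h ↦ h.1, fun h ↦ ⟨h, ?_⟩⟩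
  obtain ⟨Dh, hB⟩ :=
    Delbourgo2002.mainTheorem.exists_leadingTermClauses hDel hp5 hcm hadd hX.typeGOrd
  exact ⟨Dh, hB, (hX.schneider_and_padicVal_identity_rankOne_of_wuthrichHalf_of_cert hWu hmodD hGZK
    hp5 he hr hcert hB).1⟩

/-! ### §6 The headline from ONE `p`-adic unit -/

omit [W.IsGloballyMinimal] in
/-- `ord_{s=1} L(E,s) ≠ 0 ⟹ L(E,1) = 0` (the tree's `analyticRank_eq_zero_iff`, modularity for the
continuation). [folklore] -/
theorem entireLFunction_one_eq_zero_of_analyticRank_ne_zero (hmod : hasEntireLFunction_rat)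
    (hr : W.analyticRank ≠ 0) : W.entireLFunction 1 = 0 := by
  by_contra h
  exact hr ((W.analyticRank_eq_zero_iff_holds (hmod W)).mpr h)

/-- **HEADLINE (X4♯(G-ord) ∩ `I₀*` ∩ {`ρ̄` onto}, `p ≥ 5`, `E` non-CM, `r_an = 1`, non-anomalous):
`BSD(E,p) ⟺ ord_p q + ord_p Reg_p(E,Dh) = 1` for every (B)-datum `Dh`, GIVEN Kato's divisibility and ONE
`p`-adic unit** — the linear coefficient of the Néron-normalised `ω^{(p−1)/2}`-branch of the
Mazur–Tate–Teitelbaum series of `E♭` (`hone`). All other inputs published (Kato 17.4 (3) component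
reading `hK`, Pal 2012 Thm. 3.2 `hPal` at `p ≡ 1 (mod 4)`, GZK, modularity) or kernel.
[cite: Kato2004Asterisque, Thm. 17.4 (3) (p. 273)] [cite: Delbourgo2002, Theorem (B) (p. 40)]
[cite: Pal2012, Thm. 3.2] [cite: Miller2011LMS, Def. 1.1] -/
theorem ClassX4Gord.bsdp_iff_padicVal_rankOne_of_katoHalf_of_norm_coeff_one
    (hK : Wuthrich2014.kato_halfEigenCharIdeal_dvd_cyclotomicPrime_of_surjective)
    (hPal : Pal2012.thm32_sqrt_mul_realPeriodRat_twist_eq_of_prime_one_mod_four)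
    (hmodD : nonempty_modularParametrizationData)
    (hGZK : rank_eq_analyticRank_of_analyticRank_le_one) (hmod : hasEntireLFunction_rat)
    (hX : ClassX4Gord W p) (hp5 : 5 ≤ p) (he : semistabilityIndex W p = 2) (hsurj : Surj W p)
    (hr : W.analyticRank = 1) (hna : ReductionNonAnomalous W p)
    (hone : ∀ (V : WeierstrassCurve ℚ) [V.IsElliptic] [V.IsGloballyMinimal] (C : VariableChange ℚ),
      C • V.quadraticTwist ((-1 : ℚ) ^ (p / 2) * p) = W → IsOrdinaryAt V p →
      ∀ {N : ℕ} [NeZero N] (f : CuspForm (Gamma0 N) 2), IsNewformOf V f →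
      ∀ ϖ : ℚ, (if Even (p / 2) then (ϖ : ℝ) * V.realPeriodRat = plusPeriod f
          else (ϖ : ℝ) * V.imaginaryPeriodRat = minusPeriod f) →
        ‖PowerSeries.coeff 1 (PowerSeries.C (ϖ : ℚ_[p]) *
            (if Even (p / 2) then padicLFunctionBranch f ((unitRoot V p : ℤ_[p]) : ℚ_[p]) (p / 2)
              else padicLFunctionMinusBranch f ((unitRoot V p : ℤ_[p]) : ℚ_[p]) (p / 2)))‖ = 1)
    {Dh : PAdicHeightData W p} (hB : LeadingTermClauses W p Dh)
    {q : ℚ} (hLq : W.leadingLCoeff = (q : ℂ) * (W.realPeriodRat : ℂ) * (W.regulator : ℂ)) :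
    BSDp W p ↔ padicValRat p q + (padicRegulator Dh).valuation = 1 :=
  hX.bsdp_iff_padicVal_rankOne_of_katoHalf_of_cert hK hmodD hGZK hmod hp5 he hsurj hr hna
    (branchUnitCertificateAt_of_norm_coeff_one hPal hmod (by omega) hX.addv.2
      (entireLFunction_one_eq_zero_of_analyticRank_ne_zero hmod (by rw [hr]; exact one_ne_zero)) hone)
    hB hLq

/-- **HEADLINE, X3 twin (X3♯(G-ord) ∩ `I₀*`, `p ≥ 5`, `E` non-CM, `r_an = 1`, non-anomalous):
`BSD(E,p) ⟺ ord_p q + ord_p Reg_p(E,Dh) = 1` given Wuthrich's divisibility and ONE `p`-adic unit.**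
[cite: Wuthrich2014, Thm. 16 (p. 397)] [cite: Delbourgo2002, Theorem (B) (p. 40)]
[cite: Pal2012, Thm. 3.2] [cite: Miller2011LMS, Def. 1.1] -/
theorem ClassX3Gord.bsdp_iff_padicVal_rankOne_of_wuthrichHalf_of_norm_coeff_one
    (hWu : Wuthrich2014.thm16_halfEigenCharIdeal_dvd_cyclotomicPrime)
    (hPal : Pal2012.thm32_sqrt_mul_realPeriodRat_twist_eq_of_prime_one_mod_four)
    (hmodD : nonempty_modularParametrizationData)
    (hGZK : rank_eq_analyticRank_of_analyticRank_le_one) (hmod : hasEntireLFunction_rat)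
    (hX : ClassX3Gord W p) (hp5 : 5 ≤ p) (he : semistabilityIndex W p = 2)
    (hr : W.analyticRank = 1) (hna : ReductionNonAnomalous W p)
    (hone : ∀ (V : WeierstrassCurve ℚ) [V.IsElliptic] [V.IsGloballyMinimal] (C : VariableChange ℚ),
      C • V.quadraticTwist ((-1 : ℚ) ^ (p / 2) * p) = W → IsOrdinaryAt V p →
      ∀ {N : ℕ} [NeZero N] (f : CuspForm (Gamma0 N) 2), IsNewformOf V f →
      ∀ ϖ : ℚ, (if Even (p / 2) then (ϖ : ℝ) * V.realPeriodRat = plusPeriod f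
          else (ϖ : ℝ) * V.imaginaryPeriodRat = minusPeriod f) →
        ‖PowerSeries.coeff 1 (PowerSeries.C (ϖ : ℚ_[p]) *
            (if Even (p / 2) then padicLFunctionBranch f ((unitRoot V p : ℤ_[p]) : ℚ_[p]) (p / 2)
              else padicLFunctionMinusBranch f ((unitRoot V p : ℤ_[p]) : ℚ_[p]) (p / 2)))‖ = 1)
    {Dh : PAdicHeightData W p} (hB : LeadingTermClauses W p Dh)
    {q : ℚ} (hLq : W.leadingLCoeff = (q : ℂ) * (W.realPeriodRat : ℂ) * (W.regulator : ℂ)) :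
    BSDp W p ↔ padicValRat p q + (padicRegulator Dh).valuation = 1 :=
  hX.bsdp_iff_padicVal_rankOne_of_wuthrichHalf_of_cert hWu hmodD hGZK hmod hp5 he hr hna
    (branchUnitCertificateAt_of_norm_coeff_one hPal hmod (by omega) hX.addv
      (entireLFunction_one_eq_zero_of_analyticRank_ne_zero hmod (by rw [hr]; exact one_ne_zero)) hone)
    hB hLq

end Summit.BirchSwinnertonDyer.Rank1Residual.Additive

end
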